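import Summits.ValiantsHypothesis.ValiantsHypothesis.Theorems.BinomialElusivePeelingLemmaArmTrivial
import Summits.ValiantsHypothesis.ValiantsHypothesis.Theorems.BinomialElusivePeelingLemmaGadgetBlock

/-!
# Gadget-level rigidity (§3g STEP 3 concluded): in a one-spider configuration the antisymmetric content vanishes

Helper for the crux stmt-ValiantsHypothesis-7391 (negative lane; `Cruxes/PeelingLemma/DETERMINISTIC-ALLX.md`
§3g STEP 3 / §3h (E4)).  Pure arithmetic over the five arms of the block gadget: `d j` is the
antisymmetric edge content of arm `j` (finite support, windows of mass `≤ ℓ < 2q`, total mass near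
`b` `≤ ℓ`), `c` the centre of the loaded spider, `v_j = 2q - blockAge j c` the class of `c` on arm
`j`.  HYPOTHESES = the conclusions of §3g STEP 2: the `S⁻` private readings vanish off the rays of `c`
(`hread`) and the `S⁻` readings of the other `b`-letters vanish (`hbeta`, in the form delivered by
`vsum_apply_beta`: `Σ_j d j 0 + Σ_j P_j(2q - blockAge j c') = 0`).  CONCLUSION: `d ≡ 0` on every arm
(`gadget_rigid`).  The design enters exactly once: a non-trivial arm has the centre OLD on it
(`two_mul_add_one_le_of_caseA`, `ℓ ≤ 2R+1`), and `blockAge_old_arm_eq'` allows only one such arm;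
the reading of any other `b`-letter then kills it.  No windows; no Theses import.
-/

namespace Summit.ValiantsHypothesis.ValiantsHypothesis.Theorems.PeelingLemmaGadget

-- summit = sub-problem name (single-conjunct summit, D-0017 layout), so the namespace repeats it
set_option linter.dupNamespace false

open scoped BigOperators
open Finset
open Summit.ValiantsHypothesis.ValiantsHypothesis.Theorems.PeelingLemmaRigidity

variable {q R : ℕ}

/-- **Gadget rigidity.**  See the file header. -/
theorem gadget_rigid {ℓ M : ℕ} (hq : 1 ≤ q) (hℓ : ℓ < 2 * q) (hRq : 9 * R + 8 ≤ 2 * q) (hRℓ : ℓ ≤ 2 * R + 1)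
    (c : Fin (2 * q + 1)) (d : Fin 5 → ℕ → ℤ)
    (hdM : ∀ j t, M ≤ t → d j t = 0)
    (hmass : ∀ j a, ∑ t ∈ Finset.Ico a (a + 2 * q), |d j t| ≤ ℓ)
    (hcost : ∀ j, ∑ t ∈ Finset.range (2 * q + 1), |d j t| ≤ ℓ)
    (hread : ∀ j t₀, 1 ≤ t₀ → t₀ ≤ M →
      (t₀ - 1) % (2 * q + 1) ≠ 2 * q - ((blockAge q R j c : Fin (2 * q + 1)) : ℕ) →
      ∑ t ∈ Finset.Icc t₀ (t₀ + 2 * q), (-1 : ℤ) ^ (t - t₀) * (d j t - d j (t - 1)) = 0)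
    (hbeta : ∀ c' : Fin (2 * q + 1), c' ≠ c →
      (∑ j, d j 0) + ∑ j, ∑ t ∈ Finset.Icc 1 (2 * q - ((blockAge q R j c' : Fin (2 * q + 1)) : ℕ)),
        (-1 : ℤ) ^ t * (d j t - d j (t - 1)) = 0) :
    ∀ j t, d j t = 0 := by
  -- abbreviations
  set f : Fin 5 → Fin (2 * q + 1) → ℕ := fun j x => ((blockAge q R j x : Fin (2 * q + 1)) : ℕ) with hf
  have hflt : ∀ j x, f j x < 2 * q + 1 := fun j x => (blockAge q R j x).isLt
  have hfinj : ∀ j x y, f j x = f j y → x = y := fun j x y h => by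
    have : blockAge q R j x = blockAge q R j y := Fin.ext h
    have := congrArg (blockAge q R j) this
    rwa [blockAge_blockAge, blockAge_blockAge] at this
  let P : Fin 5 → ℕ → ℤ := fun j s => ∑ t ∈ Finset.Icc 1 s, (-1 : ℤ) ^ t * (d j t - d j (t - 1))
  -- per-arm facts
  have hreadj : ∀ j, ∀ t₀, 1 ≤ t₀ → t₀ ≤ M → (t₀ - 1) % (2 * q + 1) ≠ 2 * q - f j c →
      ∑ t ∈ Finset.Icc t₀ (t₀ + 2 * q), (-1 : ℤ) ^ (t - t₀) * (d j t - d j (t - 1)) = 0 :=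
    fun j => hread j
  -- "trivial" arms vanish identically
  have htrivA : ∀ j, 1 ≤ 2 * q - f j c → P j (2 * q - f j c) = 0 → ∀ t, d j t = 0 := fun j hv hz =>
    arm_trivial_caseA (q := q) (v := 2 * q - f j c) (M := M) hq hv (by omega) hℓ (d j) (hdM j) (hmass j)
      (hreadj j) hz
  have htrivB : ∀ j, 2 * q - f j c = 0 → d j 0 = 0 → ∀ t, d j t = 0 := fun j hv hz =>
    arm_trivial_caseB (q := q) (M := M) hq hℓ (d j) (hdM j) (hmass j)
      (fun t₀ h1 h2 h3 => hreadj j t₀ h1 h2 (by rw [hv]; exact h3)) hz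
  -- "non-trivial" arms have the centre old
  have hold : ∀ j, ¬ (∀ t, d j t = 0) → 2 * q - R ≤ f j c := by
    intro j hj
    by_cases hv : 2 * q - f j c = 0
    · have := hflt j c; omega
    · have hv1 : 1 ≤ 2 * q - f j c := by omega
      have hnt : P j (2 * q - f j c) ≠ 0 := fun hz => hj (htrivA j hv1 hz)
      have h := two_mul_add_one_le_of_caseA (q := q) (v := 2 * q - f j c) (M := M) hv1 (by omega) hℓ
        (d j) (hdM j) (hmass j) (hreadj j) hnt
        (le_trans (Finset.sum_le_sum_of_subset_of_nonneg
          (fun t ht => Finset.mem_range.mpr (by have := Finset.mem_range.mp ht; omega))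
          (fun t _ _ => abs_nonneg _)) (hcost j))
      omega
  -- at most one non-trivial arm
  have huniq : ∀ j j', ¬ (∀ t, d j t = 0) → ¬ (∀ t, d j' t = 0) → j = j' := fun j j' hj hj' =>
    blockAge_old_arm_eq' hRq c (hold j hj) (hold j' hj')
  -- suppose some arm is non-trivial and derive a contradiction from a second b-letter
  by_contra hcon
  push Not at hcon
  obtain ⟨j₀, t₀, hjt⟩ := hcon
  have hj₀ : ¬ (∀ t, d j₀ t = 0) := fun h => hjt (h t₀)
  have hothers : ∀ j, j ≠ j₀ → ∀ t, d j t = 0 := fun j hj => by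
    by_contra h; exact hj (huniq j j₀ h hj₀)
  -- a second letter c' ≠ c
  obtain ⟨c', hc'⟩ : ∃ c' : Fin (2 * q + 1), c' ≠ c :=
    ⟨if c = ⟨0, by omega⟩ then ⟨1, by omega⟩ else ⟨0, by omega⟩, by
      split_ifs with h
      · rw [h]; intro h'; exact absurd (congrArg Fin.val h') (by simp)
      · exact fun h' => h h'.symm⟩
  have hb := hbeta c' hc'
  -- the other arms contribute nothing
  have hP0 : ∀ j, j ≠ j₀ → ∀ s, P j s = 0 := fun j hj s =>
    Finset.sum_eq_zero fun t _ => by rw [hothers j hj t, hothers j hj (t - 1), sub_self, mul_zero]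
  have hsum1 : ∑ j, d j 0 = d j₀ 0 := by
    rw [Finset.sum_eq_single_of_mem j₀ (Finset.mem_univ _)]
    exact fun j _ hj => hothers j hj 0
  have hsum2 : ∑ j, P j (2 * q - f j c') = P j₀ (2 * q - f j₀ c') := by
    rw [Finset.sum_eq_single_of_mem j₀ (Finset.mem_univ _)]
    exact fun j _ hj => hP0 j hj _
  change (∑ j, d j 0) + ∑ j, P j (2 * q - f j c') = 0 at hb
  rw [hsum1, hsum2] at hb
  have hs'ne : 2 * q - f j₀ c' ≠ 2 * q - f j₀ c := by
    intro h
    have h1 := hflt j₀ c; have h2 := hflt j₀ c'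
    exact hc' (hfinj j₀ c' c (by omega))
  by_cases hv : 2 * q - f j₀ c = 0
  · -- Case B on arm j₀: P j₀ s = d j₀ 0 on [1, 2q]
    have hB := arm_rigid_caseB (q := q) (M := M) hq hℓ (d j₀) (hdM j₀) (hmass j₀)
      (fun t₀ h1 h2 h3 => hreadj j₀ t₀ h1 h2 (by rw [hv]; exact h3))
    have h1 : P j₀ (2 * q - f j₀ c') = d j₀ 0 :=
      hB _ (by omega) (by omega)
    rw [h1] at hb
    have hd0 : d j₀ 0 = 0 := by linarith
    exact hj₀ (htrivB j₀ hv hd0)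
  · -- Case A on arm j₀
    have hv1 : 1 ≤ 2 * q - f j₀ c := by omega
    obtain ⟨hoffA, -, hd0, -, -⟩ := arm_rigid_caseA (q := q) (v := 2 * q - f j₀ c) (M := M) hv1
      (by omega) hℓ (d j₀) (hdM j₀) (hmass j₀) (hreadj j₀)
    have h1 : P j₀ (2 * q - f j₀ c') = 0 := hoffA _ (by omega) hs'ne
    rw [h1, add_zero] at hb
    -- d j₀ 0 = 0 forces the centre reading to vanish
    have hPv : P j₀ (2 * q - f j₀ c) = 0 := by
      have h2 : d j₀ 0 = -2 * (-1) ^ (2 * q - f j₀ c) * P j₀ (2 * q - f j₀ c) := hd0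
      rw [hb] at h2
      have hne : (-2 : ℤ) * (-1) ^ (2 * q - f j₀ c) ≠ 0 :=
        mul_ne_zero (by norm_num) (pow_ne_zero _ (by norm_num))
      rcases mul_eq_zero.mp h2.symm with h | h
      · exact absurd h hne
      · exact h
    exact hj₀ (htrivA j₀ hv1 hPv)

end Summit.ValiantsHypothesis.ValiantsHypothesis.Theorems.PeelingLemmaGadget
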